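import Mathlib

/-!
# Singular-layer energy bounds for the leaf-function part of the mean-flow response

Solo-blind programme, steady door R4c, paper §24.17 (g-vii)(6) and hypothesis (c2)₁.

Writing the `m = 0` response as a leaf function `Φ(ψ₀)` plus an oscillating part and eliminating
the latter, the leaf-function part obeys `c_a Φ'' + ν k Φ'''' + … = G`, where the coefficient
`c_a` (the circulation / commutator coefficient `c_H` of §24.16) is `> 0` on a non-degenerate band
of an inertially forced, non-Arnold carrier and `≡ 0` for an Euler-equilibrium carrier.
Abstractly this is `c • u + ν • A u = g` with `A` positive semidefinite on a real inner product
space.  The three estimates below organise the limit `ν → 0`: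

* `norm_le_of_coercive_layer` : `‖u‖ ≤ ‖g‖ / c`, uniformly in `ν ≥ 0` (no such bound at `c = 0`);
* `layer_energy_le` / `layer_gradient_sq_le` : `ν ⟪A u, u⟫ ≤ ‖g‖² / c`, i.e. with `⟪A v, v⟫ = ‖D v‖²`
  the "gradient" obeys `ν ‖D u‖² ≤ ‖g‖² / c` — the `ν^{-1/2}` growth of response gradients for rough
  data (the contact kink of the Thomas–Fermi pattern);
* `norm_sub_limit_le` : with `u₀ := c⁻¹ • g`, `‖u - u₀‖ ≤ ν ‖A u₀‖ / c` — for smooth data the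
  viscous term is a regular perturbation and the response converges at rate `ν / c`.
-/

namespace Summit.AnomalousDissipation.AnomalousDissipation.Theorems

open scoped InnerProductSpace

variable {E : Type*} [NormedAddCommGroup E] [InnerProductSpace ℝ E]

/-- The basic identity: pairing `c • u + ν • A u = g` with `u`. -/
theorem layer_pairing_identity (c ν : ℝ) (A : E →ₗ[ℝ] E) (u g : E)
    (h : c • u + ν • A u = g) : c * ‖u‖ ^ 2 + ν * ⟪A u, u⟫_ℝ = ⟪g, u⟫_ℝ := by
  have h1 : ⟪c • u + ν • A u, u⟫_ℝ = ⟪g, u⟫_ℝ := by rw [h]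
  rw [inner_add_left, real_inner_smul_left, real_inner_smul_left, real_inner_self_eq_norm_sq] at h1
  exact h1

/-- Uniform-in-`ν` a-priori bound: if `c > 0`, `ν ≥ 0`, `A ≥ 0` and `c • u + ν • A u = g`, then
`‖u‖ ≤ ‖g‖ / c`. -/
theorem norm_le_of_coercive_layer (c ν : ℝ) (hc : 0 < c) (hν : 0 ≤ ν) (A : E →ₗ[ℝ] E)
    (hA : ∀ v, 0 ≤ ⟪A v, v⟫_ℝ) (u g : E) (h : c • u + ν • A u = g) : ‖u‖ ≤ ‖g‖ / c := by
  have hid := layer_pairing_identity c ν A u g h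
  have h2 : ⟪g, u⟫_ℝ ≤ ‖g‖ * ‖u‖ := real_inner_le_norm g u
  have h3 : 0 ≤ ν * ⟪A u, u⟫_ℝ := mul_nonneg hν (hA u)
  have key : c * ‖u‖ ^ 2 ≤ ‖g‖ * ‖u‖ := by nlinarith
  rw [le_div_iff₀ hc]
  rcases eq_or_lt_of_le (norm_nonneg u) with hu | hu
  · rw [← hu]; simp
  · have : c * ‖u‖ ≤ ‖g‖ := by
      have hk : (c * ‖u‖) * ‖u‖ ≤ ‖g‖ * ‖u‖ := by nlinarith
      exact le_of_mul_le_mul_right hk hu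
    linarith [this]

/-- Energy in the layer: `ν ⟪A u, u⟫ ≤ ‖g‖² / c`. -/
theorem layer_energy_le (c ν : ℝ) (hc : 0 < c) (hν : 0 ≤ ν) (A : E →ₗ[ℝ] E)
    (hA : ∀ v, 0 ≤ ⟪A v, v⟫_ℝ) (u g : E) (h : c • u + ν • A u = g) :
    ν * ⟪A u, u⟫_ℝ ≤ ‖g‖ ^ 2 / c := by
  have hid := layer_pairing_identity c ν A u g h
  have hu := norm_le_of_coercive_layer c ν hc hν A hA u g h
  have h2 : ⟪g, u⟫_ℝ ≤ ‖g‖ * ‖u‖ := real_inner_le_norm g u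
  have h4 : ‖g‖ * ‖u‖ ≤ ‖g‖ * (‖g‖ / c) := mul_le_mul_of_nonneg_left hu (norm_nonneg g)
  have h5 : ‖g‖ * (‖g‖ / c) = ‖g‖ ^ 2 / c := by ring
  have h6 : 0 ≤ c * ‖u‖ ^ 2 := by positivity
  linarith

/-- Gradient form of the layer energy: if `⟪A v, v⟫ = ‖D v‖²` for a linear `D`, then
`ν ‖D u‖² ≤ ‖g‖² / c` — response gradients grow at most like `ν^{-1/2}` for rough data. -/
theorem layer_gradient_sq_le {F : Type*} [NormedAddCommGroup F] [InnerProductSpace ℝ F]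
    (c ν : ℝ) (hc : 0 < c) (hν : 0 ≤ ν) (A : E →ₗ[ℝ] E) (D : E →ₗ[ℝ] F)
    (hAD : ∀ v, ⟪A v, v⟫_ℝ = ‖D v‖ ^ 2) (u g : E) (h : c • u + ν • A u = g) :
    ν * ‖D u‖ ^ 2 ≤ ‖g‖ ^ 2 / c := by
  have hA : ∀ v, 0 ≤ ⟪A v, v⟫_ℝ := fun v => by rw [hAD v]; positivity
  have := layer_energy_le c ν hc hν A hA u g h
  rw [hAD u] at this
  exact this

/-- Regular perturbation for smooth data: with `u₀ := c⁻¹ • g` (the inviscid response),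
`‖u - u₀‖ ≤ ν ‖A u₀‖ / c`.  For a kink in the data `A u₀` is unbounded and only the two energy
bounds above survive. -/
theorem norm_sub_limit_le (c ν : ℝ) (hc : 0 < c) (hν : 0 ≤ ν) (A : E →ₗ[ℝ] E)
    (hA : ∀ v, 0 ≤ ⟪A v, v⟫_ℝ) (u g : E) (h : c • u + ν • A u = g) :
    ‖u - c⁻¹ • g‖ ≤ ν * ‖A (c⁻¹ • g)‖ / c := by
  have hc0 : c ≠ 0 := hc.ne'
  have h' : c • (u - c⁻¹ • g) + ν • A (u - c⁻¹ • g) = -(ν • A (c⁻¹ • g)) := by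
    rw [smul_sub, map_sub, smul_sub, smul_smul, mul_inv_cancel₀ hc0, one_smul]
    have : c • u + ν • A u - g - ν • A (c⁻¹ • g) = -(ν • A (c⁻¹ • g)) := by rw [h]; abel
    rw [← this]; abel
  have := norm_le_of_coercive_layer c ν hc hν A hA (u - c⁻¹ • g) (-(ν • A (c⁻¹ • g))) h'
  rw [norm_neg, norm_smul, Real.norm_eq_abs, abs_of_nonneg hν] at this
  exact this

/-- The dichotomy in one statement: at `c > 0` the response is bounded by `‖g‖ / c` for every
`ν ≥ 0` and converges to the inviscid response at rate `ν ‖A u₀‖ / c`. -/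
theorem coercive_layer_summary (c ν : ℝ) (hc : 0 < c) (hν : 0 ≤ ν) (A : E →ₗ[ℝ] E)
    (hA : ∀ v, 0 ≤ ⟪A v, v⟫_ℝ) (u g : E) (h : c • u + ν • A u = g) :
    ‖u‖ ≤ ‖g‖ / c ∧ ν * ⟪A u, u⟫_ℝ ≤ ‖g‖ ^ 2 / c ∧ ‖u - c⁻¹ • g‖ ≤ ν * ‖A (c⁻¹ • g)‖ / c :=
  ⟨norm_le_of_coercive_layer c ν hc hν A hA u g h, layer_energy_le c ν hc hν A hA u g h,
    norm_sub_limit_le c ν hc hν A hA u g h⟩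

end Summit.AnomalousDissipation.AnomalousDissipation.Theorems
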